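import Summits.FinalStateConjecture.FinalStateConjecture.Theses.HarmonicFluxCensus
import Literature.Geometry.Lorentzian.MaximalDataScalarCurvature
import Literature.Geometry.Lorentzian.AsymptoticFlatness

open scoped Manifold ContDiff Topology BigOperators ENNReal Classical
open Set Filter MeasureTheory

noncomputable section

namespace Summit.FinalStateConjecture.FinalStateConjecture.Cruxes.BoundedCensusGeometry.Split

/-!
# Birth skeleton of piece 2 `NonnegScalarCensusInequality` (split of `BoundedCensusGeometry`, stmt-17468)

The Hodge-theoretic line of the route (its informal supports FluxFormsLowerBound / RelativeCLRHodgeBound),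
typed: `u : Fin n → X → ℝ` ranges over `C²` functions, `h`-harmonic on the common exterior `Ω`
(`tr_h Hess u = 0`, `PseudoRiemannianMetric.dalembertian`), of finite Dirichlet energy on `Ω`, constant
on each boundary component, with linearly independent gradient fields on `Ω`.
-/

/-- Piece 2 of the split (verbatim the child statement to be filed on the route). -/
def NonnegScalarCensusInequality : Prop :=
  ∀ c₁ Q₀ : ℝ, ∃ N₀ : ℕ, ∀ (X : Type) [TopologicalSpace X] [ChartedSpace (EuclideanSpace ℝ (Fin 3)) X] [IsManifold (𝓡 3) ((⊤ : ENat) : WithTop ENat) X] [T2Space X] [LocallyCompactSpace X] [MeasurableSpace X] [BorelSpace X] [ConnectedSpace X] (D : Literature.Geometry.Lorentzian.InitialDataSet (𝓡 3) X), (∀ [D.metric.HasLeviCivita], D.IsComplete → (∀ x, 0 ≤ D.metric.scalarCurvature x) → ∀ (m : ℕ) (S : Fin m → Literature.Geometry.Lorentzian.OutermostMOTS (𝓡 3) D.h D.k), (∀ j, ConnectedSpace (S j).surf) → (∀ j, IsCompact (((S j).exterior : Set X))ᶜ ∧ (interior (((S j).exterior : Set X))ᶜ).Nonempty) → Pairwise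 (fun j j' ↦ Disjoint (((S j).exterior : Set X))ᶜ (((S j').exterior : Set X))ᶜ) → (∀ ζ : X → ℝ, ContMDiff (𝓡 3) 𝓘(ℝ, ℝ) 1 ζ → HasCompactSupport ζ → (∫⁻ x in ⋂ j, ((S j).exterior : Set X), ENNReal.ofReal (|ζ x| ^ 6) ∂(Literature.Geometry.Lorentzian.riemannianMeasure D.h)) ^ (1 / 3 : ℝ) ≤ ENNReal.ofReal c₁ * ∫⁻ x in ⋂ j, ((S j).exterior : Set X), ENNReal.ofReal (D.metric.innerDual x (mvfderiv (𝓡 3) ζ x).toLinearMap (mvfderiv (𝓡 3) ζ x).toLinearMap) ∂(Literature.Geometry.Lorentzian.riemannianMeasure D.h)) → (∫⁻ x in ⋂ j, ((S j).exterior : Set X), ENNReal.ofReal ((D.metric.normSq x (D.metric.ricci x)) ^ (3 / 4 : ℝ)) ∂(Literature.Geometry.Lorentzian.riemannianMeasure D.h)) + ∑ j, (∫⁻ x in Set.range (S j).f, ENNReal.ofReal (D.normSqK x) ∂(Literature.Geometry.Lorentzian.riemannianVolume D.h 2)) ≤ ENNReal.ofReal Q₀ → m ≤ N₀)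

/-- **stub FL — flux forms (lower bound)**: on the common exterior `Ω` of `m` disjoint compact bodies in a
complete data set whose exterior carries a Neumann–Sobolev inequality (non-parabolicity), the capacitary
potentials `u_j` (`h`-harmonic on `Ω`, `u_j = δ_jl` on `S_l`, finite energy) exist and their gradients are
`m` linearly independent fields on `Ω` (Li–Tam 1992; the route's FluxFormsLowerBound). -/
theorem stub_fluxForms :
    ∀ c₁ : ℝ, ∀ (X : Type) [TopologicalSpace X] [ChartedSpace (EuclideanSpace ℝ (Fin 3)) X] [IsManifold (𝓡 3) ((⊤ : ENat) : WithTop ENat) X] [T2Space X] [LocallyCompactSpace X] [MeasurableSpace X] [BorelSpace X] [ConnectedSpace X] (D : Literature.Geometry.Lorentzian.InitialDataSet (𝓡 3) X), (∀ [D.metric.HasLeviCivita], D.IsComplete → ∀ (m : ℕ) (S : Fin m → Literature.Geometry.Lorentzian.OutermostMOTS (𝓡 3) D.h D.k), (∀ j, ConnectedSpace (S j).surf) → (∀ j, IsCompact (((S j).exterior : Set X))ᶜ ∧ (interior (((S j).exterior : Set X))ᶜ).Nonempty) → Pairwise (fun j j' ↦ Disjoint (((S j).exterior : Set X))ᶜ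 (((S j').exterior : Set X))ᶜ) → (∀ ζ : X → ℝ, ContMDiff (𝓡 3) 𝓘(ℝ, ℝ) 1 ζ → HasCompactSupport ζ → (∫⁻ x in ⋂ j, ((S j).exterior : Set X), ENNReal.ofReal (|ζ x| ^ 6) ∂(Literature.Geometry.Lorentzian.riemannianMeasure D.h)) ^ (1 / 3 : ℝ) ≤ ENNReal.ofReal c₁ * ∫⁻ x in ⋂ j, ((S j).exterior : Set X), ENNReal.ofReal (D.metric.innerDual x (mvfderiv (𝓡 3) ζ x).toLinearMap (mvfderiv (𝓡 3) ζ x).toLinearMap) ∂(Literature.Geometry.Lorentzian.riemannianMeasure D.h)) → ∃ u : Fin m → X → ℝ, (∀ i, ContMDiff (𝓡 3) 𝓘(ℝ, ℝ) 2 (u i)) ∧ (∀ i, ∀ x ∈ ⋂ j, ((S j).exterior : Set X), D.metric.dalembertian (u i) x = 0) ∧ (∀ i, ∫⁻ x in ⋂ j, ((S j).exterior : Set X), ENNReal.ofReal (D.metric.innerDual x (mvfderiv (𝓡 3) (u i) x).toLinearMap (mvfderiv (𝓡 3) (u i) x).toLinearMap) ∂(Literature.Geometry.Lorentzian.riemannianMeasure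 D.h) < ⊤) ∧ (∀ i j, ∃ a : ℝ, ∀ y, u i ((S j).f y) = a) ∧ LinearIndependent ℝ (fun i ↦ (fun x ↦ if x ∈ ⋂ j, ((S j).exterior : Set X) then mvfderiv (𝓡 3) (u i) x else 0 : Π x : X, TangentSpace (𝓡 3) x →L[ℝ] ℝ))) := by
  sorry

/-- **stub HC — relative CLR–Hodge count (upper bound)**: under a Neumann–Sobolev constant `c₁`,
nonnegative scalar curvature and census functional `≤ Q₀`, the number of linearly independent finite-energy
harmonic gradient fields on `Ω` with locally constant boundary values is bounded by `N(c₁, Q₀)`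
(Carron 1999 / Li–Yau 1983 CLR count of zero modes of `∇*∇ + Ric` with a boundary `δ`-potential of
strength `H`, `H² = (tr_S k)² ≤ 2|k|²` on a MOTS; the route's RelativeCLRHodgeBound). -/
theorem stub_hodgeCount :
    ∀ c₁ Q₀ : ℝ, ∃ N : ℕ, ∀ (X : Type) [TopologicalSpace X] [ChartedSpace (EuclideanSpace ℝ (Fin 3)) X] [IsManifold (𝓡 3) ((⊤ : ENat) : WithTop ENat) X] [T2Space X] [LocallyCompactSpace X] [MeasurableSpace X] [BorelSpace X] [ConnectedSpace X] (D : Literature.Geometry.Lorentzian.InitialDataSet (𝓡 3) X), (∀ [D.metric.HasLeviCivita], D.IsComplete → (∀ x, 0 ≤ D.metric.scalarCurvature x) → ∀ (m : ℕ) (S : Fin m → Literature.Geometry.Lorentzian.OutermostMOTS (𝓡 3) D.h D.k), (∀ j, ConnectedSpace (S j).surf) → (∀ j, IsCompact (((S j).exterior : Set X))ᶜ ∧ (interior (((S j).exterior : Set X))ᶜ).Nonempty) → Pairwise (fun j j' ↦ Disjoint (((S j).exterior : Set X))ᶜ (((S j').exterior : Set X))ᶜ) → (∀ ζ : X → ℝ,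 ContMDiff (𝓡 3) 𝓘(ℝ, ℝ) 1 ζ → HasCompactSupport ζ → (∫⁻ x in ⋂ j, ((S j).exterior : Set X), ENNReal.ofReal (|ζ x| ^ 6) ∂(Literature.Geometry.Lorentzian.riemannianMeasure D.h)) ^ (1 / 3 : ℝ) ≤ ENNReal.ofReal c₁ * ∫⁻ x in ⋂ j, ((S j).exterior : Set X), ENNReal.ofReal (D.metric.innerDual x (mvfderiv (𝓡 3) ζ x).toLinearMap (mvfderiv (𝓡 3) ζ x).toLinearMap) ∂(Literature.Geometry.Lorentzian.riemannianMeasure D.h)) → (∫⁻ x in ⋂ j, ((S j).exterior : Set X), ENNReal.ofReal ((D.metric.normSq x (D.metric.ricci x)) ^ (3 / 4 : ℝ)) ∂(Literature.Geometry.Lorentzian.riemannianMeasure D.h)) + ∑ j, (∫⁻ x in Set.range (S j).f, ENNReal.ofReal (D.normSqK x) ∂(Literature.Geometry.Lorentzian.riemannianVolume D.h 2)) ≤ ENNReal.ofReal Q₀ → ∀ (n : ℕ) (u : Fin n → X → ℝ), (∀ i, ContMDiff (𝓡 3) 𝓘(ℝ, ℝ) 2 (u i)) ∧ (∀ i, ∀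 x ∈ ⋂ j, ((S j).exterior : Set X), D.metric.dalembertian (u i) x = 0) ∧ (∀ i, ∫⁻ x in ⋂ j, ((S j).exterior : Set X), ENNReal.ofReal (D.metric.innerDual x (mvfderiv (𝓡 3) (u i) x).toLinearMap (mvfderiv (𝓡 3) (u i) x).toLinearMap) ∂(Literature.Geometry.Lorentzian.riemannianMeasure D.h) < ⊤) ∧ (∀ i j, ∃ a : ℝ, ∀ y, u i ((S j).f y) = a) ∧ LinearIndependent ℝ (fun i ↦ (fun x ↦ if x ∈ ⋂ j, ((S j).exterior : Set X) then mvfderiv (𝓡 3) (u i) x else 0 : Π x : X, TangentSpace (𝓡 3) x →L[ℝ] ℝ)) → n ≤ N) := by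
  sorry

/-- **Composition** `stub FL → stub HC → NonnegScalarCensusInequality` (kernel-checked). -/
theorem nonnegScalarCensusInequality_of_statements :
    (∀ c₁ : ℝ, ∀ (X : Type) [TopologicalSpace X] [ChartedSpace (EuclideanSpace ℝ (Fin 3)) X] [IsManifold (𝓡 3) ((⊤ : ENat) : WithTop ENat) X] [T2Space X] [LocallyCompactSpace X] [MeasurableSpace X] [BorelSpace X] [ConnectedSpace X] (D : Literature.Geometry.Lorentzian.InitialDataSet (𝓡 3) X), (∀ [D.metric.HasLeviCivita], D.IsComplete → ∀ (m : ℕ) (S : Fin m → Literature.Geometry.Lorentzian.OutermostMOTS (𝓡 3) D.h D.k), (∀ j, ConnectedSpace (S j).surf) → (∀ j, IsCompact (((S j).exterior : Set X))ᶜ ∧ (interior (((S j).exterior : Set X))ᶜ).Nonempty) → Pairwise (fun j j' ↦ Disjoint (((S j).exterior : Set X))ᶜ (((S j').exterior : Set X))ᶜ) → (∀ ζ : X → ℝ, ContMDiff (𝓡 3) 𝓘(ℝ, ℝ) 1 ζ → HasCompactSupport ζ → (∫⁻ x in ⋂ j, ((S j).exterior : Set X), ENNReal.ofReal (|ζ x|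 ^ 6) ∂(Literature.Geometry.Lorentzian.riemannianMeasure D.h)) ^ (1 / 3 : ℝ) ≤ ENNReal.ofReal c₁ * ∫⁻ x in ⋂ j, ((S j).exterior : Set X), ENNReal.ofReal (D.metric.innerDual x (mvfderiv (𝓡 3) ζ x).toLinearMap (mvfderiv (𝓡 3) ζ x).toLinearMap) ∂(Literature.Geometry.Lorentzian.riemannianMeasure D.h)) → ∃ u : Fin m → X → ℝ, (∀ i, ContMDiff (𝓡 3) 𝓘(ℝ, ℝ) 2 (u i)) ∧ (∀ i, ∀ x ∈ ⋂ j, ((S j).exterior : Set X), D.metric.dalembertian (u i) x = 0) ∧ (∀ i, ∫⁻ x in ⋂ j, ((S j).exterior : Set X), ENNReal.ofReal (D.metric.innerDual x (mvfderiv (𝓡 3) (u i) x).toLinearMap (mvfderiv (𝓡 3) (u i) x).toLinearMap) ∂(Literature.Geometry.Lorentzian.riemannianMeasure D.h) < ⊤) ∧ (∀ i j, ∃ a : ℝ, ∀ y, u i ((S j).f y) = a) ∧ LinearIndependent ℝ (fun i ↦ (fun x ↦ if x ∈ ⋂ j, ((S j).exterior : Set X) then mvfderiv (𝓡 3) (u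 i) x else 0 : Π x : X, TangentSpace (𝓡 3) x →L[ℝ] ℝ)))) →
    (∀ c₁ Q₀ : ℝ, ∃ N : ℕ, ∀ (X : Type) [TopologicalSpace X] [ChartedSpace (EuclideanSpace ℝ (Fin 3)) X] [IsManifold (𝓡 3) ((⊤ : ENat) : WithTop ENat) X] [T2Space X] [LocallyCompactSpace X] [MeasurableSpace X] [BorelSpace X] [ConnectedSpace X] (D : Literature.Geometry.Lorentzian.InitialDataSet (𝓡 3) X), (∀ [D.metric.HasLeviCivita], D.IsComplete → (∀ x, 0 ≤ D.metric.scalarCurvature x) → ∀ (m : ℕ) (S : Fin m → Literature.Geometry.Lorentzian.OutermostMOTS (𝓡 3) D.h D.k), (∀ j, ConnectedSpace (S j).surf) → (∀ j, IsCompact (((S j).exterior : Set X))ᶜ ∧ (interior (((S j).exterior : Set X))ᶜ).Nonempty) → Pairwise (fun j j' ↦ Disjoint (((S j).exterior : Set X))ᶜ (((S j').exterior : Set X))ᶜ) → (∀ ζ : X → ℝ, ContMDiff (𝓡 3) 𝓘(ℝ, ℝ) 1 ζ → HasCompactSupport ζ → (∫⁻ x in ⋂ j, ((S j).exterior : Set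 X), ENNReal.ofReal (|ζ x| ^ 6) ∂(Literature.Geometry.Lorentzian.riemannianMeasure D.h)) ^ (1 / 3 : ℝ) ≤ ENNReal.ofReal c₁ * ∫⁻ x in ⋂ j, ((S j).exterior : Set X), ENNReal.ofReal (D.metric.innerDual x (mvfderiv (𝓡 3) ζ x).toLinearMap (mvfderiv (𝓡 3) ζ x).toLinearMap) ∂(Literature.Geometry.Lorentzian.riemannianMeasure D.h)) → (∫⁻ x in ⋂ j, ((S j).exterior : Set X), ENNReal.ofReal ((D.metric.normSq x (D.metric.ricci x)) ^ (3 / 4 : ℝ)) ∂(Literature.Geometry.Lorentzian.riemannianMeasure D.h)) + ∑ j, (∫⁻ x in Set.range (S j).f, ENNReal.ofReal (D.normSqK x) ∂(Literature.Geometry.Lorentzian.riemannianVolume D.h 2)) ≤ ENNReal.ofReal Q₀ → ∀ (n : ℕ) (u : Fin n → X → ℝ), (∀ i, ContMDiff (𝓡 3) 𝓘(ℝ, ℝ) 2 (u i)) ∧ (∀ i, ∀ x ∈ ⋂ j, ((S j).exterior : Set X), D.metric.dalembertian (u i) x = 0) ∧ (∀ i, ∫⁻ x in ⋂ j, ((S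 j).exterior : Set X), ENNReal.ofReal (D.metric.innerDual x (mvfderiv (𝓡 3) (u i) x).toLinearMap (mvfderiv (𝓡 3) (u i) x).toLinearMap) ∂(Literature.Geometry.Lorentzian.riemannianMeasure D.h) < ⊤) ∧ (∀ i j, ∃ a : ℝ, ∀ y, u i ((S j).f y) = a) ∧ LinearIndependent ℝ (fun i ↦ (fun x ↦ if x ∈ ⋂ j, ((S j).exterior : Set X) then mvfderiv (𝓡 3) (u i) x else 0 : Π x : X, TangentSpace (𝓡 3) x →L[ℝ] ℝ)) → n ≤ N)) →
      id NonnegScalarCensusInequality := by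
  intro hFL hHC
  show NonnegScalarCensusInequality
  intro c₁ Q₀
  obtain ⟨N, hN⟩ := hHC c₁ Q₀
  refine ⟨N, fun X _ _ _ _ _ _ _ _ D ↦ ?_⟩
  intro _ hcomp hR m S hS hB hdisj hsob hQ
  obtain ⟨u, hu⟩ := hFL c₁ X D hcomp m S hS hB hdisj hsob
  exact hN X D hcomp hR m S hS hB hdisj hsob hQ m u hu

/-- **Composition (skeleton theorem).** The piece `NonnegScalarCensusInequality` BY NAME and without hypotheses, from the two stubs. -/
theorem NonnegScalarCensusInequality_of : NonnegScalarCensusInequality :=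
  nonnegScalarCensusInequality_of_statements stub_fluxForms stub_hodgeCount

end Summit.FinalStateConjecture.FinalStateConjecture.Cruxes.BoundedCensusGeometry.Split

end
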